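import Mathlib
import Literature.NumberTheory.Sieve.SingularSeries
import Literature.NumberTheory.Sieve.LevelOfDistribution
import Literature.NumberTheory.Sieve.BombieriFriedlanderIwaniecCombinatorics
import Literature.NumberTheory.Sieve.GoldstonYildirimLemma21
import Literature.Barriers.Parity.FordMaynardPrimeSieves

/-!
# Crux `EngineToPairs` (stmt-Parity-14659) — ideator 1, round 1: first lemmas of the two idea cards

Card A `bfi-transplant-correlation-sieve` (the sieve half `X1 ∧ X2 ∧ BVLiouville ⟹ TAvg`):
* `TypeIBound`, `TypeIIBound`, `TypeI2Bound` — Ford–Maynard-shaped information predicates for a weight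
  `w` at height `x` with an explicit budget `T` (cf. `Literature.Barriers.Parity.FordMaynard.TypeI/TypeII`,
  which hard-wire the budget `x/(log x)^B`; the Type-I₂ predicate is the shape of the crux `TypeI2Dilated`);
* `edgeMass`, `bulkMass` — the trivially bounded parts (BFI §15 slivers and the `log → constant` error);
* `CorrelationSieveBound` — the weight-agnostic correlation-sieve inequality in BFI-verbatim form (fine boxes,
  slivers), and `CorrelationSieveBoundSharp` — the same with NO edge/bulk terms (the load-bearing stub of the line);
* `engine_trichotomy` — PROVED: the exponent classification (Type II window / Type I / Type I₂ box) behind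
  the Heath-Brown `K = 3` casework, from the tree's `BFI.exists_subsum_mem_Icc_or`;
* `typeII_of_fourthMoment` — PROVED: the two-Cauchy–Schwarz step turning the crux's table fourth moment
  into a bilinear (Type-II) bound, coefficient-agnostic.
Card B `tavg-hinge-gy-normal-form` (the hinge and the EH half):
* `TAvg` (common height) and `TAvgMax` (per-modulus heights), `TAvgMax_of_TAvg` (the gridding step, statement);
* `PairsFromTAvg` — the EH half in Goldston–Yıldırım normal form, typed against the tree's
  `goldstonYildirim_lemma21_log_j1 / _j1` shapes;
* `EngineToPairs_of_cards` — PROVED: the two halves compose to the crux BY NAME.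
-/

namespace Summit.Parity.GeneralizedHardyLittlewood.Cruxes.EngineToPairs.Ideator1

open Finset Real


/-! ## Verbatim mirrors of the route decls used below

(This published copy does not import the route module `Theses.LiouvilleShiftedTables` — the farm snapshot of
that module was incoherent when this workfile was written — so the five route decls it mentions are copied
VERBATIM from `lean/Summits/Parity/GeneralizedHardyLittlewood/Theses/LiouvilleShiftedTables.lean` (rev 9);
in tree each `X' ↔ Theses.LiouvilleShiftedTables.X` is `Iff.rfl`.  The ideator's folder copy `Sketch.lean`
imports the route module instead and was checked rc 0 against it.) -/

/-- mirror of `Theses.LiouvilleShiftedTables.DilatedTableChowla` (X1). -/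
def DilatedTableChowla : Prop :=
  ∀ c : ℤ, c ≠ 0 → ∀ δ : ℝ, 0 < δ → δ ≤ 1 / 12 → ∀ C : ℝ, 0 < C → ∃ x₀ : ℝ, ∀ x : ℝ, x₀ ≤ x → ∀ A : ℝ, x ^ δ ≤ A → A ≤ x ^ (1 / 3 + δ) → ∀ u v : ℕ → ℕ, (∑ q ∈ Finset.Icc 1 ⌊x ^ (δ / 2)⌋₊, (q : ℝ) ^ 3 * ∑ a ∈ (Finset.Ioc ⌊A⌋₊ ⌊2 * A⌋₊).filter (fun a : ℕ => a ≡ u q [MOD q]), ∑ a' ∈ (Finset.Ioc ⌊A⌋₊ ⌊2 * A⌋₊).filter (fun a' : ℕ => a' ≡ u q [MOD q]), (∑ b ∈ (Finset.Icc 1 ⌊x / A⌋₊).filter (fun b : ℕ => b ≡ v q [MOD q]), (ArithmeticFunction.liouville (Int.toNat ((a : ℤ) * b + c)) : ℝ) * (ArithmeticFunction.liouville (Int.toNat ((a' : ℤ) * b + c)) : ℝ)) ^ 2) ≤ x ^ 2 / Real.log x ^ C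

/-- mirror of `Theses.LiouvilleShiftedTables.TypeI2Dilated` (X2). -/
def TypeI2Dilated : Prop :=
  ∀ c : ℤ, c ≠ 0 → ∃ ρ : ℝ, 0 < ρ ∧ ∀ A : ℝ, 0 < A → ∃ C x₀ : ℝ, ∀ x : ℝ, x₀ ≤ x → ∀ w : ℕ, ∀ R S y : ℝ, 1 ≤ R → R ≤ x ^ ρ → 0 ≤ S → S * R ≤ x ^ (1 / 2 + ρ) → 0 ≤ y → y ≤ x → (∑ q ∈ Finset.Icc 1 ⌊x ^ ρ⌋₊, ∑ r ∈ Finset.Icc 1 ⌊R⌋₊, |∑ s ∈ Finset.Icc 1 ⌊S⌋₊, ∑ n ∈ (Finset.Icc 1 ⌊y / (s * r)⌋₊).filter (fun n : ℕ => r * s * n ≡ w [MOD q]), (ArithmeticFunction.liouville (Int.toNat ((r : ℤ) * s * n + c)) : ℝ)|) ≤ C * x / Real.log x ^ A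

/-- mirror of `Theses.LiouvilleShiftedTables.ElliottHalberstam` (the bridge crux, by name). -/
def ElliottHalberstam : Prop :=
  Literature.NumberTheory.Sieve.LevelOfDistribution.ElliottHalberstam

/-- mirror of `Theses.LiouvilleShiftedTables.EH` (verbatim-Mathlib EH; `Iff.rfl` with the previous). -/
def EH : Prop :=
  ∀ θ : ℝ, θ < 1 → ∀ A : ℝ, 0 < A → ∀ ε : ℝ, 0 < ε → (fun x : ℝ => ∑ q ∈ Finset.Icc 1 ⌊x ^ (θ - ε)⌋₊, ⨆ y : ↥(Set.Icc (1 : ℝ) x), ⨆ a : (ZMod q)ˣ, |(∑ n ∈ Finset.range (⌊(y : ℝ)⌋₊ + 1), ArithmeticFunction.vonMangoldt.residueClass (a : ZMod q) n) - (y : ℝ) / (Nat.totient q : ℝ)|) =O[Filter.atTop] fun x : ℝ => x / Real.log x ^ A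

/-- mirror of `Theses.LiouvilleShiftedTables.BVLiouville` (PROVED in tree: `stub_bvLiouville`). -/
def BVLiouville : Prop :=
  ∀ ε : ℝ, 0 < ε → ∀ A : ℝ, 0 < A → ∃ C x₀ : ℝ, ∀ x : ℝ, x₀ ≤ x → ∀ c : ℕ → ℤ, ∀ y : ℕ → ℝ, (∀ d, 1 ≤ d → 0 ≤ c d ∧ c d < d) → (∀ d, 0 ≤ y d ∧ y d ≤ x) → (∑ d ∈ Finset.Icc 1 ⌊x ^ (1 / 2 - ε)⌋₊, |∑ n ∈ Finset.Icc 1 ⌊y d / d⌋₊, (ArithmeticFunction.liouville (Int.toNat ((d : ℤ) * n + c d)) : ℝ)|) ≤ C * x / Real.log x ^ A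

/-- mirror of `Theses.LiouvilleShiftedTables.PairsHL` (Hardy–Littlewood pairs, Λ-form, fixed shift). -/
def PairsHL : Prop :=
  ∀ h : ℕ, 1 ≤ h → (fun N : ℕ => ∑ n ∈ Finset.Icc 1 N, ArithmeticFunction.vonMangoldt n * ArithmeticFunction.vonMangoldt (n + h) - Literature.NumberTheory.Sieve.singularSeries ({0, (h : ℤ)} : Finset ℤ) * N) =o[Filter.atTop] fun N : ℕ => (N : ℝ)

/-! ## Card A — information predicates with explicit budgets -/

/-- Type-I information for `w` on `(x/2, x]`: level `x^γ`, divisor exponent `B`, budget `T`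
(Ford–Maynard (I) with `x/(log x)^B` replaced by `T`; the `max` over intervals as a choice function). -/
def TypeIBound (w : ℕ → ℝ) (x γ B T : ℝ) : Prop :=
  ∀ I : ℕ → ℕ × ℕ,
    ∑ m ∈ Icc 1 ⌊x ^ γ⌋₊, ((m.divisors.card : ℝ) ^ B) *
        |∑ n ∈ (Icc (I m).1 (I m).2).filter
            (fun n : ℕ => x / 2 < (m * n : ℝ) ∧ (m * n : ℝ) ≤ x), w (m * n)| ≤ T

/-- Type-II information for `w` on `(x/2, x]` in the range `[θ, θ + ν]` with divisor-bounded coefficients,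
budget `T` (Ford–Maynard (II) with an explicit budget; real coefficients suffice here). -/
def TypeIIBound (w : ℕ → ℝ) (x θ ν B T : ℝ) : Prop :=
  ∀ ξ κ : ℕ → ℝ, (∀ m, |ξ m| ≤ (m.divisors.card : ℝ) ^ B) →
    (∀ n, |κ n| ≤ (n.divisors.card : ℝ) ^ B) →
      |∑ m ∈ (Icc 1 ⌊x ^ (θ + ν)⌋₊).filter (fun m : ℕ => (x / 2) ^ θ < (m : ℝ)),
          ∑ n ∈ (Icc 1 ⌊x⌋₊).filter (fun n : ℕ => x / 2 < (m * n : ℝ) ∧ (m * n : ℝ) ≤ x),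
            ξ m * κ n * w (m * n)| ≤ T

/-- Type-I₂ information for `w` on `(x/2, x]`: a rough outer variable `r ≤ R ≤ x^ρ` with divisor weights and
absolute values, two SMOOTH variables `s ≤ S`, `n ≤ y/(sr)` (coefficient `1`), `SR ≤ x^{1/2+σ}`, all `y ≤ x`
— exactly the region shape of the crux `TypeI2Dilated` (flat cut-off in `s`, hyperbolic in `n`). -/
def TypeI2Bound (w : ℕ → ℝ) (x ρ σ B T : ℝ) : Prop :=
  ∀ R S y : ℝ, 1 ≤ R → R ≤ x ^ ρ → 0 ≤ S → S * R ≤ x ^ (1 / 2 + σ) → 0 ≤ y → y ≤ x →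
    ∑ r ∈ Icc 1 ⌊R⌋₊, ((r.divisors.card : ℝ) ^ B) *
      |∑ s ∈ Icc 1 ⌊S⌋₊, ∑ n ∈ (Icc 1 ⌊y / (s * r)⌋₊).filter
          (fun n : ℕ => x / 2 < (r * s * n : ℝ)), w (r * s * n)| ≤ T

/-- The sliver mass of `w`: divisor-weighted `|w|` over the two edges of `(x/2, x]` of relative width
`(1+Δ)^6` (the non-interior box-tuples of BFI §15 live there). -/
noncomputable def edgeMass (w : ℕ → ℝ) (x Δ B : ℝ) : ℝ :=
  ∑ n ∈ (Ioc ⌊x / 2⌋₊ ⌊x⌋₊).filter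
      (fun n : ℕ => (n : ℝ) ≤ x / 2 * (1 + Δ) ^ 6 ∨ x / (1 + Δ) ^ 6 < (n : ℝ)),
    ((n.divisors.card : ℝ) ^ B) * |w n|

/-- The bulk mass of `w`: divisor-weighted `|w|` over `(x/2, x]` (multiplies the `log → box constant` error `Δ`). -/
noncomputable def bulkMass (w : ℕ → ℝ) (x B : ℝ) : ℝ :=
  ∑ n ∈ Ioc ⌊x / 2⌋₊ ⌊x⌋₊, ((n.divisors.card : ℝ) ^ B) * |w n|

/-- **Card A, load-bearing statement (the weight-agnostic correlation sieve).**  For `0 < δ ≤ 1/100` there is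
a divisor exponent `B` such that for every sliver fineness `A₁` and all large `x`, for EVERY weight `w` and
budgets `TI, TII, TI2`: Type-I information of level `x^{1/2−2δ}`, Type-II information in `[δ/2, 1/3+δ]`
(the union of the crux window at `δ/2` and at `δ`) and Type-I₂ information in the box `r ≤ x^δ`,
`SR ≤ x^{1/2+3δ}` bound the correlation `∑_{x/2<n≤x} Λ(n) w(n)` by
`(log x)^C (TI + TII + TI2) + (log x)^B · edgeMass(Δ = (log x)^{-A₁}) + (log x)^{B−A₁} · bulkMass`.
Proof route: Heath-Brown's identity with `K = 3` (tree: `heathBrown_identity`, `BFI.hbPiece`), BFI §15 fine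
boxes and box-tuples (tree: `BFI.boxRestrict`, `BFI.prodMain/prodErr`, `Interior`, slivers), and the
trichotomy `engine_trichotomy` dispatching interior tuples to the three hypotheses. -/
def CorrelationSieveBound : Prop :=
  ∀ δ : ℝ, 0 < δ → δ ≤ 1 / 100 → ∃ B : ℝ, 0 < B ∧ ∀ A₁ : ℝ, 0 < A₁ → ∃ C x₀ : ℝ, ∀ x : ℝ, x₀ ≤ x →
    ∀ w : ℕ → ℝ, ∀ TI TII TI2 : ℝ, 0 ≤ TI → 0 ≤ TII → 0 ≤ TI2 →
      TypeIBound w x (1 / 2 - 2 * δ) B TI →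
      TypeIIBound w x (δ / 2) (1 / 3 + δ / 2) B TII →
      TypeI2Bound w x δ (3 * δ) B TI2 →
        |∑ n ∈ Ioc ⌊x / 2⌋₊ ⌊x⌋₊, ArithmeticFunction.vonMangoldt n * w n| ≤
          C * Real.log x ^ C * (TI + TII + TI2)
            + C * Real.log x ^ B * edgeMass w x (Real.log x ^ (-A₁)) B
            + C * Real.log x ^ (B - A₁) * bulkMass w x B

/-- **Card A, load-bearing statement, SHARP form (the one the line should prove).**  Same hypotheses as
`CorrelationSieveBound`, NO edge/bulk terms: with Ford–Maynard-shaped hypotheses the sharp cut-off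
`x/2 < n ≤ x` is absorbed EXACTLY — Heath-Brown `K = 3`, plain DYADIC boxes (`Δ = 1`) for the Möbius
variables and for the smooth variables `≤ x^{1/3}`, the (at most two) smooth variables `> x^{1/3}` left
FREE: a free long variable ranges over an interval (Type I, `max_I`), or sits inside the `n`-group of a
bilinear form whose constraint `x/2 < mn ≤ x` is part of `TypeIIBound`, or is the hyperbolic variable of
`TypeI2Bound`, the other balanced one being cut FLAT at frontiers chosen per `r`-box with slack `δ/10`;
`log` factors go by partial summation (`∀ I`, `∀ S`, `∀ y`) or into the divisor-bounded coefficients as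
`log(·)/log x ≤ 1`.  So none of BFI's fine boxes `Δ = ℒ^{-A₁}`, slivers or `log → constant` errors occur in
the sieve stage; the only separation-of-variables step of the whole line is inside the instantiation
`DilatedTableChowla ⇒ TypeIIBound` (rectangular table vs. `mn ≤ x`). -/
def CorrelationSieveBoundSharp : Prop :=
  ∀ δ : ℝ, 0 < δ → δ ≤ 1 / 100 → ∃ B C x₀ : ℝ, ∀ x : ℝ, x₀ ≤ x →
    ∀ w : ℕ → ℝ, ∀ TI TII TI2 : ℝ, 0 ≤ TI → 0 ≤ TII → 0 ≤ TI2 →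
      TypeIBound w x (1 / 2 - 2 * δ) B TI →
      TypeIIBound w x (δ / 2) (1 / 3 + δ / 2) B TII →
      TypeI2Bound w x δ (3 * δ) B TI2 →
        |∑ n ∈ Ioc ⌊x / 2⌋₊ ⌊x⌋₊, ArithmeticFunction.vonMangoldt n * w n| ≤
          C * Real.log x ^ C * (TI + TII + TI2)

/-- **Card A, PROVED: the exponent trichotomy** behind the `K = 3` Heath-Brown casework of `CorrelationSieveBound`.
Exponents `f i ≥ 0` of the boxes of an interior tuple sum to `1`; the Möbius boxes have exponent
`≤ 1/3 + δ/20`.  Then either (Type II) a partial sum lies in `[3δ/5, 1/3 + 9δ/10]` (inside the crux window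
`[δ/2, 1/3+δ]` with slack `δ/10` on both sides), or (Type I) a smooth box has exponent `≥ 1/2 + 21δ/10` (so the
rest is a modulus `≤ x^{1/2 − 21δ/10}`, below the BV level `x^{1/2−2δ}`), or (Type I₂) two smooth boxes lie in
`(1/2 − 3δ, 1/2 + 21δ/10)` and everything else totals `< 3δ/5` (`r < x^{3δ/5} ≤ x^δ`,
`SR ≤ x^{1/2 + 27δ/10} ≤ x^{1/2+3δ}`).  [folklore; the tree's `BFI.exists_subsum_mem_Icc_or`] -/
theorem engine_trichotomy {ι : Type*} [Fintype ι] [DecidableEq ι] (f : ι → ℝ) (smooth : ι → Prop)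
    [DecidablePred smooth] {δ : ℝ} (hδ : 0 < δ) (hδ' : δ ≤ 1 / 100) (hnn : ∀ i, 0 ≤ f i)
    (hsum : ∑ i, f i = 1) (hmu : ∀ i, ¬ smooth i → f i ≤ 1 / 3 + δ / 20) :
    (∃ s : Finset ι, 3 * δ / 5 ≤ ∑ i ∈ s, f i ∧ ∑ i ∈ s, f i ≤ 1 / 3 + 9 * δ / 10) ∨
    (∃ i, smooth i ∧ 1 / 2 + 21 * δ / 10 ≤ f i) ∨
    (∃ i j, i ≠ j ∧ smooth i ∧ smooth j ∧
        1 / 2 - 3 * δ < f i ∧ f i < 1 / 2 + 21 * δ / 10 ∧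
        1 / 2 - 3 * δ < f j ∧ f j < 1 / 2 + 21 * δ / 10 ∧
        ∑ k ∈ (univ.erase i).erase j, f k < 3 * δ / 5) := by
  rcases Literature.NumberTheory.Sieve.BFI.exists_subsum_mem_Icc_or f (a := 3 * δ / 5)
      (b := 1 / 3 + 9 * δ / 10) (by positivity) (by linarith) with h | ⟨hsmall, hbig⟩
  · exact Or.inl h
  right
  have hsub : ∀ t : Finset ι, (∀ k ∈ t, f k < 3 * δ / 5) → ∑ k ∈ t, f k < 3 * δ / 5 := by
    intro t ht
    refine lt_of_le_of_lt ?_ hsmall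
    apply Finset.sum_le_sum_of_subset_of_nonneg
    · intro k hk
      exact Finset.mem_filter.2 ⟨Finset.mem_univ _, ht k hk⟩
    · intro k _ _
      exact hnn k
  have hsmooth : ∀ i, 3 * δ / 5 ≤ f i → smooth i := by
    intro i hi
    by_contra hns
    have h1 := hmu i hns
    have h2 := hbig i hi
    linarith
  have hex : ∃ i, 3 * δ / 5 ≤ f i := by
    by_contra hnone
    push Not at hnone
    have h1 := hsub univ (fun k _ => hnone k)
    have h2 : ∑ k ∈ univ, f k = 1 := hsum
    linarith
  obtain ⟨i, hi⟩ := hex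
  have hTi : ∑ k ∈ univ.erase i, f k = 1 - f i := by
    rw [Finset.sum_erase_eq_sub (Finset.mem_univ i)]
    have h2 : ∑ k ∈ univ, f k = 1 := hsum
    rw [h2]
  by_cases hcase : ∀ j ∈ univ.erase i, f j < 3 * δ / 5
  · left
    refine ⟨i, hsmooth i hi, ?_⟩
    have h1 := hsub _ hcase
    rw [hTi] at h1
    linarith
  · push Not at hcase
    obtain ⟨j, hjmem, hj⟩ := hcase
    have hji : j ≠ i := Finset.ne_of_mem_erase hjmem
    have hTij : ∑ k ∈ (univ.erase i).erase j, f k = 1 - f i - f j := by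
      rw [Finset.sum_erase_eq_sub hjmem, hTi]
    have hrest : ∀ k ∈ (univ.erase i).erase j, f k < 3 * δ / 5 := by
      intro k hk
      by_contra hk'
      push Not at hk'
      have hbk := hbig k hk'
      have hbi := hbig i hi
      have hbj := hbig j hj
      have hle : f k ≤ ∑ l ∈ (univ.erase i).erase j, f l :=
        Finset.single_le_sum (fun l _ => hnn l) hk
      rw [hTij] at hle
      linarith
    have hsmallrest := hsub _ hrest
    by_cases hI : 1 / 2 + 21 * δ / 10 ≤ f i
    · left
      exact ⟨i, hsmooth i hi, hI⟩
    by_cases hJ : 1 / 2 + 21 * δ / 10 ≤ f j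
    · left
      exact ⟨j, hsmooth j hj, hJ⟩
    push Not at hI hJ
    right
    have hs' := hsmallrest
    rw [hTij] at hs'
    refine ⟨i, j, hji.symm, hsmooth i hi, hsmooth j hj, ?_, hI, ?_, hJ, hsmallrest⟩
    · linarith
    · linarith

/-- **Card A, PROVED: the Type-II step is two Cauchy–Schwarz inequalities.**  For any real kernel `K` and
coefficients `α, β` on finite index sets, `(∑_a ∑_b α_a β_b K(a,b))⁴ ≤ (∑ α²)² (∑ β²)² ∑_{a,a'} (∑_b K(a,b)K(a',b))²`
— the right-hand factor is the crux's table fourth moment `tr(MMᵀ)²` when `K(a,b) = λ(ab+c)` on a class block, so the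
Type-II hypothesis of `CorrelationSieveBound` is fed by `DilatedTableChowla` with NO condition on the coefficients. -/
theorem typeII_of_fourthMoment {A Bs : Finset ℕ} (α β : ℕ → ℝ) (K : ℕ → ℕ → ℝ) :
    (∑ a ∈ A, ∑ b ∈ Bs, α a * β b * K a b) ^ 4 ≤
      (∑ a ∈ A, α a ^ 2) ^ 2 * (∑ b ∈ Bs, β b ^ 2) ^ 2 *
        ∑ a ∈ A, ∑ a' ∈ A, (∑ b ∈ Bs, K a b * K a' b) ^ 2 := by
  -- first Cauchy–Schwarz, in `b`
  have h1 : (∑ a ∈ A, ∑ b ∈ Bs, α a * β b * K a b) ^ 2 ≤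
      (∑ b ∈ Bs, β b ^ 2) * ∑ b ∈ Bs, (∑ a ∈ A, α a * K a b) ^ 2 := by
    have hswap : ∑ a ∈ A, ∑ b ∈ Bs, α a * β b * K a b =
        ∑ b ∈ Bs, β b * (∑ a ∈ A, α a * K a b) := by
      rw [Finset.sum_comm]
      refine Finset.sum_congr rfl fun b _ => ?_
      rw [Finset.mul_sum]
      refine Finset.sum_congr rfl fun a _ => ?_
      ring
    rw [hswap]
    exact Finset.sum_mul_sq_le_sq_mul_sq Bs β (fun b => ∑ a ∈ A, α a * K a b)
  -- expand the square in `b` as a quadratic form in `(a, a')` with Gram kernel `G`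
  have h2 : ∑ b ∈ Bs, (∑ a ∈ A, α a * K a b) ^ 2 =
      ∑ a ∈ A, ∑ a' ∈ A, α a * α a' * ∑ b ∈ Bs, K a b * K a' b := by
    have : ∀ b ∈ Bs, (∑ a ∈ A, α a * K a b) ^ 2 =
        ∑ a ∈ A, ∑ a' ∈ A, α a * α a' * (K a b * K a' b) := by
      intro b _
      rw [sq, Finset.sum_mul_sum]
      refine Finset.sum_congr rfl fun a _ => Finset.sum_congr rfl fun a' _ => ?_
      ring
    rw [Finset.sum_congr rfl this, Finset.sum_comm]
    refine Finset.sum_congr rfl fun a _ => ?_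
    rw [Finset.sum_comm]
    refine Finset.sum_congr rfl fun a' _ => ?_
    rw [Finset.mul_sum]
  -- second Cauchy–Schwarz, in `(a, a')`
  have h3 : (∑ a ∈ A, ∑ a' ∈ A, α a * α a' * ∑ b ∈ Bs, K a b * K a' b) ^ 2 ≤
      (∑ a ∈ A, ∑ a' ∈ A, (α a * α a') ^ 2) *
        ∑ a ∈ A, ∑ a' ∈ A, (∑ b ∈ Bs, K a b * K a' b) ^ 2 := by
    have e1 : ∑ a ∈ A, ∑ a' ∈ A, α a * α a' * ∑ b ∈ Bs, K a b * K a' b =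
        ∑ p ∈ A ×ˢ A, (α p.1 * α p.2) * ∑ b ∈ Bs, K p.1 b * K p.2 b := by
      rw [Finset.sum_product]
    have e2 : ∑ a ∈ A, ∑ a' ∈ A, (α a * α a') ^ 2 = ∑ p ∈ A ×ˢ A, (α p.1 * α p.2) ^ 2 := by
      rw [Finset.sum_product]
    have e3 : ∑ a ∈ A, ∑ a' ∈ A, (∑ b ∈ Bs, K a b * K a' b) ^ 2 =
        ∑ p ∈ A ×ˢ A, (∑ b ∈ Bs, K p.1 b * K p.2 b) ^ 2 := by
      rw [Finset.sum_product]
    rw [e1, e2, e3]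
    exact Finset.sum_mul_sq_le_sq_mul_sq (A ×ˢ A) (fun p => α p.1 * α p.2)
      (fun p => ∑ b ∈ Bs, K p.1 b * K p.2 b)
  have h4 : ∑ a ∈ A, ∑ a' ∈ A, (α a * α a') ^ 2 = (∑ a ∈ A, α a ^ 2) ^ 2 := by
    rw [sq (∑ a ∈ A, α a ^ 2), Finset.sum_mul_sum]
    refine Finset.sum_congr rfl fun a _ => Finset.sum_congr rfl fun a' _ => ?_
    ring
  -- assemble
  have hB : 0 ≤ ∑ b ∈ Bs, β b ^ 2 := Finset.sum_nonneg fun b _ => sq_nonneg _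
  have hQ : 0 ≤ ∑ b ∈ Bs, (∑ a ∈ A, α a * K a b) ^ 2 := Finset.sum_nonneg fun b _ => sq_nonneg _
  calc (∑ a ∈ A, ∑ b ∈ Bs, α a * β b * K a b) ^ 4
      = ((∑ a ∈ A, ∑ b ∈ Bs, α a * β b * K a b) ^ 2) ^ 2 := by ring
    _ ≤ ((∑ b ∈ Bs, β b ^ 2) * ∑ b ∈ Bs, (∑ a ∈ A, α a * K a b) ^ 2) ^ 2 :=
        pow_le_pow_left₀ (sq_nonneg _) h1 2
    _ = (∑ b ∈ Bs, β b ^ 2) ^ 2 * (∑ a ∈ A, ∑ a' ∈ A, α a * α a' * ∑ b ∈ Bs, K a b * K a' b) ^ 2 := by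
        rw [mul_pow, h2]
    _ ≤ (∑ b ∈ Bs, β b ^ 2) ^ 2 * ((∑ a ∈ A, α a ^ 2) ^ 2 *
          ∑ a ∈ A, ∑ a' ∈ A, (∑ b ∈ Bs, K a b * K a' b) ^ 2) := by
        rw [← h4]
        exact mul_le_mul_of_nonneg_left h3 (sq_nonneg _)
    _ = _ := by ring

/-! ## Card B — the hinge `TAvg` and the EH half in Goldston–Yıldırım normal form -/

/-- **The hinge, common-height form** (what Card A delivers): for every shift `h ≥ 1` there is `ε > 0` such that
for every `A`, uniformly in the height `y ≤ x`,
`∑_{q ≤ x^ε} |∑_{n ≤ y, n ≡ h (q)} Λ(n) λ(n − h)| ≤ C x (log x)^{−A}`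
(λ of shifted primes in progressions, Bombieri–Vinogradov-averaged over tiny moduli; no log weights, no `μ`). -/
def TAvg : Prop :=
  ∀ h : ℕ, 1 ≤ h → ∃ ε : ℝ, 0 < ε ∧ ∀ A : ℝ, 0 < A → ∃ C x₀ : ℝ, ∀ x : ℝ, x₀ ≤ x → ∀ y : ℝ, 0 ≤ y → y ≤ x →
    ∑ q ∈ Icc 1 ⌊x ^ ε⌋₊,
        |∑ n ∈ (Icc 1 ⌊y⌋₊).filter (fun n : ℕ => n ≡ h [MOD q]),
            ArithmeticFunction.vonMangoldt n * (ArithmeticFunction.liouville (n - h) : ℝ)| ≤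
      C * x / Real.log x ^ A

/-- **The hinge, per-modulus-height form** (what the Goldston–Yıldırım normal form consumes): as `TAvg` but with
one height `y_q ≤ x` per modulus. -/
def TAvgMax : Prop :=
  ∀ h : ℕ, 1 ≤ h → ∃ ε : ℝ, 0 < ε ∧ ∀ A : ℝ, 0 < A → ∃ C x₀ : ℝ, ∀ x : ℝ, x₀ ≤ x →
    ∀ y : ℕ → ℝ, (∀ q, 0 ≤ y q ∧ y q ≤ x) →
      ∑ q ∈ Icc 1 ⌊x ^ ε⌋₊,
          |∑ n ∈ (Icc 1 ⌊y q⌋₊).filter (fun n : ℕ => n ≡ h [MOD q]),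
              ArithmeticFunction.vonMangoldt n * (ArithmeticFunction.liouville (n - h) : ℝ)| ≤
        C * x / Real.log x ^ A

/-- **Gridding step** (S-sized, Card B): common heights give per-modulus heights at the cost of `(log x)^{A'}`
grid points plus a Chebyshev/Brun–Titchmarsh bound on gaps of length `x (log x)^{−A'}`. Statement only. -/
def TAvgMax_of_TAvg : Prop := TAvg → TAvgMax

/-- **Card B, the EH half in Goldston–Yıldırım normal form** (statement of the line; the two GY facts are to be
PROVED by the line, they are in the signature only to display the dependency): with `R = N^{1−ε}`,
`∑_{n≤N} Λ(n)Λ(n+h) = ∑ Λ_R(n)Λ(n+h) + ∑ (Λ−Λ_R)(n)Λ(n+h)`; the first sum and the `d ≤ R` part of the second are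
Type-I in `Λ(·+h)` at level `N^{1−ε}` (the crux `EH` at `θ = 1 − ε/2`) with main terms
`N · ∑_{d≤R,(d,h)=1} μ(d) log(R/d)/φ(d) = 𝔖({0,h}) N + o(N)` (GY (2.11), `j = 1`) and
`(N log(N/R) − N) ∑_{d≤R,(d,h)=1} μ(d)/φ(d) = o(N)` (GY (2.13), `j = 1`); the `d > R` part is
`∑_{m<N^ε} log m ∑_{R<d≤N/m} μ(d)Λ(dm+h)`, turned into `TAvgMax` by `μ(d) = λ(d) ∑_{k²∣d} μ(k)` and
`λ(d) = λ(m) λ(p − h)` (`p = dm + h`), heights `k²mY + h`, `k ≤ (log N)⁴`. -/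
def PairsFromTAvg : Prop :=
  Literature.NumberTheory.Sieve.goldstonYildirim_lemma21_log_j1 →
    Literature.NumberTheory.Sieve.goldstonYildirim_lemma21_j1 → TAvgMax → EH → PairsHL

/-- **Card A's deliverable as an implication** (statement): the engine cruxes and the proved `BVLiouville`
give the hinge. -/
def TAvg_of_engine : Prop := DilatedTableChowla → TypeI2Dilated → BVLiouville → TAvg

/-- Verbatim mirror of the route decl `Theses.LiouvilleShiftedTables.EngineToPairs` (stmt-Parity-14659; the farm's
snapshot olean of the route module predates that decl — refuter-rattack noted the same — so the body is copied;
in tree `EngineToPairs ↔ EngineToPairsMirror` is `Iff.rfl`, cf. the refuter's W.lean). -/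
def EngineToPairsMirror : Prop :=
  DilatedTableChowla → TypeI2Dilated → ElliottHalberstam → ∀ h : ℕ, 1 ≤ h → (fun N : ℕ => ∑ n ∈ Finset.Icc 1 N, ArithmeticFunction.vonMangoldt n * ArithmeticFunction.vonMangoldt (n + h) - Literature.NumberTheory.Sieve.singularSeries ({0, (h : ℤ)} : Finset ℤ) * N) =o[Filter.atTop] fun N : ℕ => (N : ℝ)

/-- **PROVED: the two cards compose to the crux** (`ElliottHalberstam ↔ EH` and `PairsHL ↔` the inlined
conclusion are `Iff.rfl`; `BVLiouville` is proved in tree, `stub_bvLiouville`, kept as a hypothesis here to stay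
import-light). -/
theorem EngineToPairs_of_cards (hBV : BVLiouville) (hA : TAvg_of_engine) (hgrid : TAvgMax_of_TAvg)
    (hGY1 : Literature.NumberTheory.Sieve.goldstonYildirim_lemma21_log_j1)
    (hGY2 : Literature.NumberTheory.Sieve.goldstonYildirim_lemma21_j1)
    (hB : PairsFromTAvg) : EngineToPairsMirror :=
  fun hD hI hE => hB hGY1 hGY2 (hgrid (hA hD hI hBV)) hE

example : ElliottHalberstam ↔ EH := Iff.rfl

/-- Sanity: the mirror is literally `X1 → X2 → ElliottHalberstam → PairsHL`. -/
example : EngineToPairsMirror ↔ (DilatedTableChowla → TypeI2Dilated → ElliottHalberstam → PairsHL) := Iff.rfl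

end Summit.Parity.GeneralizedHardyLittlewood.Cruxes.EngineToPairs.Ideator1
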